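import Summits.AtomisticToContinuum.FouriersLaw.Theorems.OddSectorIrreversibilityOddDensityIsCorrectorStationarity
import Summits.AtomisticToContinuum.FouriersLaw.Theorems.OddSectorIrreversibilityOddDensityIsCorrectorIdentification
import Summits.AtomisticToContinuum.FouriersLaw.Theorems.OddSectorIrreversibilityOddDensityIsCorrectorMainPrep2

/-!
# `OddDensityIsCorrector`: the odd part of the response density is the normalised corrector

Closes support item `stmt-AtomisticToContinuum-9146` of route `OddSectorIrreversibility`
(`Summit.AtomisticToContinuum.FouriersLaw.Theses.OddSectorIrreversibility.OddDensityIsCorrector`),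
the McLennan / Kundu–Dhar–Narayan linear-response identity for the purely Hamiltonian bulk:

for the pinned anharmonic chain `pinnedChain ω₂ λ β γ` with unique steady states, both baths at
`T > 0`, `N ≥ 2`, and an `L²(μ_T)` response density `h` of the steady states at `T_L - T_R = δ → 0`,
the Kubo integral `u = R₀ J_tot = ∫₀^∞ P_t J_tot dt` exists (a.e., in fact everywhere, as an
absolutely convergent integral), lies in `L²(μ_T)`, and `h - h∘Θ = (u - u∘Θ)/((N-1)T²)` `μ_T`-a.e.

## Proof

(parts 1–14, files `OddSectorIrreversibilityOddDensityIsCorrector*.lean`)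
1. Stationarity of the tilted steady states, differentiated at `δ = 0` against test functions, gives
   the weak equation `∫ (LF) h dμ_T = -∫ F g dμ_T`, `g = γ(p_0² - p_{N-1}²)/(2T²)` (part 1).
2. `h` is identified: `h = μ_T(h) + (R₀ g)∘Θ` a.e. (part 12), by hypoelliptic density of
   `(λ - L)C_c^∞` in `L²(μ_T)` (Hörmander + the `L²`-energy estimate, parts 2–6), the explicit
   resolvent of the Harris-ergodic semigroup on observables of exponential-energy growth (parts 7–10),
   detailed balance `L† = ΘLΘ` and Abel limits with rates.
3. The exact energy identities `LH = γ(2T - p_0² - p_{N-1}²)`, `LX = J_tot + γ(N-1)(T - p_{N-1}²)`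
   give `LΨ = J_tot/((N-1)T²) + g` for the momentum-even `Ψ = X/((N-1)T²) - H/(2T²)`, and
   `R₀(LΨ) = μ_T(Ψ) - Ψ` a.e. (coboundary, parts 11, 13, 14); hence
   `R₀ g = μ_T(Ψ) - Ψ - R₀J_tot/((N-1)T²)` a.e., whose odd part under `Θ` is the claim.
-/

noncomputable section

open MeasureTheory ProbabilityTheory Filter Topology Set Function
open scoped ContDiff NNReal ENNReal BigOperators
open Literature.MathematicalPhysics.KineticTheory.HeatConduction
open Literature.Barriers.AtomisticToContinuum.OpenChain
open Summit.AtomisticToContinuum.FouriersLaw.Theorems.SubdiffusiveBondHeat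

namespace Summit.AtomisticToContinuum.FouriersLaw.Theorems.OddSectorIrreversibility

/-- **McLennan / Kundu–Dhar–Narayan identity** (`OddDensityIsCorrector`): for the pinned anharmonic
chain with unique steady states and both baths at `T > 0` (`N ≥ 2`), the momentum-odd part of an
`L²` linear-response density `h` is the normalised odd part of the Kubo integral of the total current,
`h - h∘Θ = (R₀J_tot - (R₀J_tot)∘Θ)/((N-1)T²)` `μ_T`-a.e., with `R₀J_tot(x) = ∫₀^∞ (P_t J_tot)(x) dt`
in `L²(μ_T)` and the finite-horizon integrals converging to it.
[cite: KunduDharNarayan2009, eqs. (reln2)–(reln3)] [cite: MaesNetocny2010, Thm 3.1] -/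
theorem oddDensityIsCorrector_proof :
    Summit.AtomisticToContinuum.FouriersLaw.Theses.OddSectorIrreversibility.OddDensityIsCorrector := by
  unfold Summit.AtomisticToContinuum.FouriersLaw.Theses.OddSectorIrreversibility.OddDensityIsCorrector
  intro ω₂ lam β γ hω hl hβ hγ hU μ hμ T hT N h hN hyp
  obtain ⟨hmem, hresp, -⟩ := hyp
  have hN0 : 0 < N := by omega
  haveI : IsProbabilityMeasure ((pinnedChain ω₂ lam β γ).gibbsMeasure N T) :=
    pinnedChain_isProbabilityMeasure_gibbsMeasure hω hl.le hβ.le γ N hT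
  -- the steady state at `T_L = T_R = T` is the Gibbs measure
  have hG : μ N T T = (pinnedChain ω₂ lam β γ).gibbsMeasure N T :=
    hU N T T hT hT _ _ (hμ N T T hT hT) (pinnedChain_isSteadyState_gibbsMeasure hω hl.le hβ.le γ N hT)
  -- the weak equation `L†h = -g`
  have hweak : ∀ F : PhaseSpace N → ℝ, ContDiff ℝ ∞ F → HasCompactSupport F →
      ∫ x, (pinnedChain ω₂ lam β γ).generator N T T F x * h x ∂((pinnedChain ω₂ lam β γ).gibbsMeasure N T) =
        -∫ x, F x * (γ / (2 * T ^ 2) * (x.2 ⟨0, by omega⟩ ^ 2 - x.2 ⟨N - 1, by omega⟩ ^ 2))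
          ∂((pinnedChain ω₂ lam β γ).gibbsMeasure N T) :=
    fun F hF hFc => integral_generator_mul_responseDensity_gibbs hN hT μ hμ hG hresp hF hFc
  rw [hG] at hmem
  rw [hG]
  -- a measurable representative `h'` of `h`
  have hh' : h =ᵐ[(pinnedChain ω₂ lam β γ).gibbsMeasure N T] hmem.1.mk h := hmem.1.ae_eq_mk
  have hh'm : Measurable (hmem.1.mk h) := hmem.1.stronglyMeasurable_mk.measurable
  have hmem' : MemLp (hmem.1.mk h) 2 ((pinnedChain ω₂ lam β γ).gibbsMeasure N T) := (memLp_congr_ae hh').1 hmem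
  have hweak' : ∀ F : PhaseSpace N → ℝ, ContDiff ℝ ∞ F → HasCompactSupport F →
      ∫ x, (pinnedChain ω₂ lam β γ).generator N T T F x * hmem.1.mk h x ∂((pinnedChain ω₂ lam β γ).gibbsMeasure N T) =
        -∫ x, F x * (γ / (2 * T ^ 2) * (x.2 ⟨0, by omega⟩ ^ 2 - x.2 ⟨N - 1, by omega⟩ ^ 2))
          ∂((pinnedChain ω₂ lam β γ).gibbsMeasure N T) := by
    intro F hF hFc
    rw [← hweak F hF hFc]
    exact integral_congr_ae (by filter_upwards [hh'] with x hx; rw [hx])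
  -- constants and the Harris bound
  set ϑ : ℝ := 1 / (4 * T) with hϑ
  have hϑ0 : 0 < ϑ := by positivity
  have h2ϑ : 2 * ϑ < 1 / T := by
    rw [hϑ, show 2 * (1 / (4 * T)) = 1 / (2 * T) by field_simp; ring, one_div_lt_one_div (by positivity) hT]; linarith
  have hϑ1 : ϑ < 1 / T := by linarith
  obtain ⟨K, c, hK, hc, hb⟩ := pinnedChain_harris_bound hω hl.le hβ hγ hN0 hT hϑ0 hϑ1
  have hE2 : Integrable (fun z => Real.exp (2 * ϑ * (pinnedChain ω₂ lam β γ).hamiltonian N z))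
      ((pinnedChain ω₂ lam β γ).gibbsMeasure N T) :=
    pinnedChain_integrable_exp_mul_hamiltonian_gibbsMeasure hω hl.le hβ.le γ N hT h2ϑ
  have hexpsq : ∀ z, Real.exp (ϑ * (pinnedChain ω₂ lam β γ).hamiltonian N z) ^ 2 =
      Real.exp (2 * ϑ * (pinnedChain ω₂ lam β γ).hamiltonian N z) := fun z => by
    rw [← Real.exp_nat_mul]; ring_nf
  -- the source `g`
  have hgc : Continuous fun x : PhaseSpace N => γ / (2 * T ^ 2) * (x.2 ⟨0, by omega⟩ ^ 2 - x.2 ⟨N - 1, by omega⟩ ^ 2) := by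
    fun_prop
  have hgb := pinnedChain_abs_mclennanSource_le hω hl.le hβ.le N (γ := γ) (T := T) hϑ0 ⟨0, by omega⟩ ⟨N - 1, by omega⟩
  have hge : ∀ y : PhaseSpace N, (fun x : PhaseSpace N => γ / (2 * T ^ 2) * (x.2 ⟨0, by omega⟩ ^ 2 - x.2 ⟨N - 1, by omega⟩ ^ 2))
      (y.1, -y.2) = (fun x : PhaseSpace N => γ / (2 * T ^ 2) * (x.2 ⟨0, by omega⟩ ^ 2 - x.2 ⟨N - 1, by omega⟩ ^ 2)) y :=
    fun y => by simp only [Pi.neg_apply, neg_sq]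
  have hg0 := pinnedChain_integral_mclennanSource_gibbsMeasure hω hl.le hβ hγ hN hT
  -- (2) identification `h' = m + (R₀ g)∘Θ`
  have hid := pinnedChain_response_identification hω hl.le hβ hγ hN hT hϑ0 h2ϑ hh'm hmem' hgc (by positivity) hgb hge hg0 hweak'
  -- (3) the Kubo integral of `LΨ`
  have hC := pinnedChain_kubo_generator_mclennanPotential hω hl.le hβ hγ hN hT
  have hD := pinnedChain_kubo_generator_ae_eq hω hl.le hβ hγ hN hT
  -- pull back along `Θ`
  have hqmp := (measurePreserving_reversal_gibbsMeasure (pinnedChain ω₂ lam β γ) N T).quasiMeasurePreserving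
  have hidΘ := hqmp.ae hid
  have hDΘ := hqmp.ae hD
  have hhΘ := hqmp.ae hh'
  simp only [momentumReversal_apply, neg_neg, Prod.mk.eta, energyMoment_neg_momentum,
    OscillatorChain.hamiltonian_neg_momentum] at hidΘ hDΘ hhΘ
  -- the total current `J_tot`
  have hJc : Continuous fun y => ∑ i : Fin N, (pinnedChain ω₂ lam β γ).bondCurrent N i y :=
    continuous_finsetSum _ fun i _ => pinnedChain_continuous_bondCurrent ω₂ lam β γ N i
  have hJb := pinnedChain_abs_totalCurrent_le hω hl.le hβ.le N (γ := γ) hϑ0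
  have hCJ : 0 ≤ N * (N * ((3 + β) / 2)) * (2 * Real.exp ϑ / ϑ ^ 2) := by have := hβ.le; positivity
  have hJ0 := pinnedChain_integral_totalCurrent_gibbsMeasure hω hl.le hβ hT (N := N) (γ := γ)
  obtain ⟨u, hu⟩ : ∃ u : PhaseSpace N → ℝ, u = fun x => ∫ t in Ioi (0 : ℝ),
    ∫ y, (∑ i : Fin N, (pinnedChain ω₂ lam β γ).bondCurrent N i y) ∂((pinnedChain ω₂ lam β γ).transitionKernel N T T t.toNNReal x) :=
    ⟨_, rfl⟩
  have hum : Measurable u := by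
    rw [hu]; exact (pinnedChain_stronglyMeasurable_kubo hω hl.le hβ.le hγ.le T T hJc.measurable).measurable
  have hub : ∀ z, |u z| ≤ K * (N * (N * ((3 + β) / 2)) * (2 * Real.exp ϑ / ϑ ^ 2)) *
      Real.exp (ϑ * (pinnedChain ω₂ lam β γ).hamiltonian N z) / c := fun z => by
    rw [hu]; exact pinnedChain_abs_kubo_le hω hl.le hβ hγ hb hc hJc hCJ hJb hJ0 z
  refine ⟨u, ?_, ?_, ?_⟩
  · -- `u ∈ L²(μ_T)`
    refine (memLp_two_iff_integrable_sq hum.aestronglyMeasurable).2 ?_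
    refine Integrable.mono' (hE2.const_mul ((K * (N * (N * ((3 + β) / 2)) * (2 * Real.exp ϑ / ϑ ^ 2)) / c) ^ 2))
      (hum.pow_const 2).aestronglyMeasurable (Eventually.of_forall fun z => ?_)
    rw [Real.norm_eq_abs, abs_pow, ← hexpsq]
    calc |u z| ^ 2 ≤ (K * (N * (N * ((3 + β) / 2)) * (2 * Real.exp ϑ / ϑ ^ 2)) *
          Real.exp (ϑ * (pinnedChain ω₂ lam β γ).hamiltonian N z) / c) ^ 2 := pow_le_pow_left₀ (abs_nonneg _) (hub z) 2
      _ = _ := by ring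
  · -- the finite-horizon Kubo integrals converge (everywhere)
    rw [hu]
    exact ae_of_all _ fun x => pinnedChain_tendsto_kubo hω hl.le hβ hγ hb hc hJc hCJ hJb hJ0 x
  · -- the identity
    filter_upwards [hh', hhΘ, hid, hidΘ, hD, hDΘ] with z e0 e0' e1 e2 e5 e6
    have e3 := hC z
    have e4 := hC (z.1, -z.2)
    rw [e0, e0', hu]
    linear_combination e1 - e2 - e4 + e3 - e5 + e6

end Summit.AtomisticToContinuum.FouriersLaw.Theorems.OddSectorIrreversibility

end
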